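import Literature.NumberTheory.LFunctions.WeilExplicitContinuous
import HarnessLib

/-!
# The Weil functional along a general approximate identity

Topic `Literature/NumberTheory/LFunctions`; complement to `WeilExplicitContinuous.lean` (same
normalisation: `ĝ(s) = weilMellin g s`, `W = weilFunctional`, `g ⋆ u = weilConv g u`).  Everything here
is PROVED; no definitions, no named facts.

`WeilExplicitContinuous.lean` proves `W(g ⋆ φ_k) → W(g)` for the SPECIFIC mollifiers
`φ_k = WeilContinuous.moll k` (normalised smooth bumps).  The Kreĭn–Bochner representation of `W`
(`WeilBochnerRepresentation.lean`) needs the same limit along the squares `φ_k ⋆ φ̃_k`, whose transforms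
on the critical line are `|φ̂_k|² ≥ 0`.  We therefore redo the argument for an ARBITRARY approximate
identity: a sequence of continuous `u_n : ℝ → ℂ` with

* `u_n(x) = 0` for `|x| ≥ δ_n`, where `δ_n ≤ 1` and `δ_n → 0`;
* `∫ u_n = 1` and `∫ ‖u_n‖ = 1` (e.g. `u_n ≥ 0`).

Then `û_n(s) → 1` for every `s` (`tendsto_weilMellin`), `|û_n(½+it)| ≤ 1` (`norm_weilMellin_half_le`),
`(g ⋆ u_n)(x) → g(x)` for continuous `g` (`tendsto_weilConv`), and for `g` continuous of compact support
with integrable archimedean integrand, `W(g ⋆ u_n) → W(g)` (`tendsto_weilFunctional`): the prime side is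
a fixed finite sum, the polar side is `ĝ(0)û_n(0) + ĝ(1)û_n(1)`, and the archimedean integral converges
by dominated convergence.  The proofs are those of `WeilExplicitContinuous.lean` (Bombieri 2000, §3, the
mollification step), with `moll k`, `rOut` replaced by `u n`, `δ n`. [cite: Bombieri2000Weil, §3]
-/

noncomputable section

open Complex Filter Set MeasureTheory Topology
open scoped Real ComplexConjugate

namespace Literature.NumberTheory.LFunctions

namespace WeilApproxIdentity

variable {g : ℝ → ℂ} {u : ℕ → ℝ → ℂ} {δ : ℕ → ℝ}

/-! ## The approximate identity -/

/-- `u_n` has compact support (it vanishes off the closed ball of radius `δ_n`). [folklore] -/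
theorem hasCompactSupport_of_vanish (hus : ∀ n x, δ n ≤ |x| → u n x = 0) (n : ℕ) :
    HasCompactSupport (u n) :=
  HasCompactSupport.intro (isCompact_closedBall (0 : ℝ) (δ n)) fun x hx => hus n x (by
    rw [Metric.mem_closedBall, dist_zero_right, Real.norm_eq_abs, not_le] at hx
    exact hx.le)

/-- `‖u_n‖` is integrable. [folklore] -/
theorem integrable_norm (huc : ∀ n, Continuous (u n)) (hus : ∀ n x, δ n ≤ |x| → u n x = 0) (n : ℕ) :
    Integrable fun x => ‖u n x‖ :=
  ((huc n).integrable_of_hasCompactSupport (hasCompactSupport_of_vanish hus n)).norm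

/-- On the critical line `|û_n(½+it)| ≤ ∫ ‖u_n‖ = 1`. [folklore] -/
theorem norm_weilMellin_half_le (hun : ∀ n, ∫ x, ‖u n x‖ = 1) (n : ℕ) (t : ℝ) :
    ‖weilMellin (u n) (1 / 2 + t * I)‖ ≤ 1 := by
  unfold weilMellin
  calc ‖∫ x : ℝ, u n x * cexp ((1 / 2 + t * I - 1 / 2) * x)‖
      ≤ ∫ x : ℝ, ‖u n x * cexp ((1 / 2 + t * I - 1 / 2) * x)‖ := norm_integral_le_integral_norm _
    _ = ∫ x : ℝ, ‖u n x‖ := by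
        congr 1 with x
        have e : (1 / 2 + (t : ℂ) * I - 1 / 2) * (x : ℂ) = ((t * x : ℝ) : ℂ) * I := by push_cast; ring
        rw [norm_mul, e, Complex.norm_exp_ofReal_mul_I, mul_one]
    _ = 1 := hun n

/-- **`û_n(s) → 1`** for every `s` (`û_n(s) - 1 = ∫ u_n(t)(e^{ct} - 1) dt`, `c = s - ½`, and
`|e^{ct} - 1| ≤ 2|c| δ_n` on the support). [folklore] -/
theorem tendsto_weilMellin (huc : ∀ n, Continuous (u n)) (hδ : Tendsto δ atTop (𝓝 0))
    (hus : ∀ n x, δ n ≤ |x| → u n x = 0) (hu1 : ∀ n, ∫ x, u n x = 1) (hun : ∀ n, ∫ x, ‖u n x‖ = 1)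
    (s : ℂ) : Tendsto (fun n => weilMellin (u n) s) atTop (𝓝 1) := by
  -- adapted from `WeilContinuous.tendsto_weilMellin_moll` (tree, `WeilExplicitContinuous.lean`)
  set c : ℂ := s - 1 / 2 with hc
  have hdiff : ∀ n, weilMellin (u n) s - 1 = ∫ t : ℝ, u n t * (cexp (c * t) - 1) := by
    intro n
    have h1 : weilMellin (u n) s - 1 = weilMellin (u n) s - ∫ t : ℝ, u n t := by rw [hu1]
    rw [h1]
    unfold weilMellin
    rw [← integral_sub]
    · refine integral_congr_ae (Eventually.of_forall fun t => ?_)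
      rw [hc]; ring
    · exact integrable_weilIntegrand (huc n) (hasCompactSupport_of_vanish hus n) s
    · exact (huc n).integrable_of_hasCompactSupport (hasCompactSupport_of_vanish hus n)
  have hbound : ∀ n, ‖c‖ * δ n ≤ 1 → ‖weilMellin (u n) s - 1‖ ≤ 2 * (‖c‖ * δ n) := by
    intro n hn1
    rw [hdiff n]
    calc ‖∫ t : ℝ, u n t * (cexp (c * t) - 1)‖ ≤ ∫ t : ℝ, ‖u n t * (cexp (c * t) - 1)‖ :=
          norm_integral_le_integral_norm _
      _ ≤ ∫ t : ℝ, ‖u n t‖ * (2 * (‖c‖ * δ n)) := by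
          refine integral_mono_of_nonneg (Eventually.of_forall fun _ => norm_nonneg _)
            ((integrable_norm huc hus n).mul_const _) (Eventually.of_forall fun t => ?_)
          simp only [norm_mul]
          rcases le_or_gt (δ n) |t| with ht | ht
          · rw [hus n t ht]; simp
          · refine mul_le_mul_of_nonneg_left ?_ (norm_nonneg _)
            have hct : ‖c * (t : ℂ)‖ ≤ ‖c‖ * δ n := by
              rw [norm_mul, Complex.norm_real, Real.norm_eq_abs]; gcongr
            calc ‖cexp (c * (t : ℂ)) - 1‖ ≤ 2 * ‖c * (t : ℂ)‖ :=
                  Complex.norm_exp_sub_one_le (x := c * (t : ℂ)) (hct.trans hn1)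
              _ ≤ 2 * (‖c‖ * δ n) := by gcongr
      _ = 2 * (‖c‖ * δ n) := by
          rw [MeasureTheory.integral_mul_const, hun, one_mul]
  have h1 : Tendsto (fun n => ‖c‖ * δ n) atTop (𝓝 (‖c‖ * 0)) := hδ.const_mul ‖c‖
  rw [mul_zero] at h1
  have hlim : Tendsto (fun n => 2 * (‖c‖ * δ n)) atTop (𝓝 (2 * 0)) := h1.const_mul 2
  rw [mul_zero] at hlim
  have hev : ∀ᶠ n in atTop, ‖weilMellin (u n) s - 1‖ ≤ 2 * (‖c‖ * δ n) := by
    filter_upwards [(tendsto_order.1 h1).2 1 one_pos] with n hn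
    exact hbound n hn.le
  have h0 : Tendsto (fun n => weilMellin (u n) s - 1) atTop (𝓝 0) := squeeze_zero_norm' hev hlim
  simpa using h0.add_const 1

/-- **Approximate identity**: `(g ⋆ u_n)(x) → g(x)` for continuous `g`. [folklore] -/
theorem tendsto_weilConv (huc : ∀ n, Continuous (u n)) (hδ : Tendsto δ atTop (𝓝 0))
    (hus : ∀ n x, δ n ≤ |x| → u n x = 0) (hu1 : ∀ n, ∫ x, u n x = 1) (hun : ∀ n, ∫ x, ‖u n x‖ = 1)
    (hgc : Continuous g) (x : ℝ) :
    Tendsto (fun n => weilConv g (u n) x) atTop (𝓝 (g x)) := by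
  -- adapted from `WeilContinuous.tendsto_weilConv_moll` (tree, `WeilExplicitContinuous.lean`)
  rw [Metric.tendsto_nhds]
  intro ε hε
  obtain ⟨η, hη, hηg⟩ := Metric.continuous_iff.1 hgc x (ε / 2) (by positivity)
  have hk : ∀ᶠ n : ℕ in atTop, δ n < η := (tendsto_order.1 hδ).2 η hη
  filter_upwards [hk] with n hn
  have hcs := hasCompactSupport_of_vanish hus n
  have hconv : weilConv g (u n) x = ∫ v : ℝ, g v * u n (x - v) := weilConv_apply g (u n) x
  have hone : ∫ v : ℝ, u n (x - v) = 1 := by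
    rw [integral_sub_left_eq_self (fun v => u n v) volume x, hu1]
  have hgx : g x = ∫ v : ℝ, g x * u n (x - v) := by
    rw [MeasureTheory.integral_const_mul, hone, mul_one]
  have hint1 : Integrable fun v : ℝ => g v * u n (x - v) := by
    have hc : Continuous fun v : ℝ => g v * u n (x - v) := hgc.mul ((huc n).comp (by fun_prop))
    refine hc.integrable_of_hasCompactSupport ?_
    exact (hcs.comp_homeomorph (Homeomorph.subLeft x)).mul_left
  have hint2 : Integrable fun v : ℝ => g x * u n (x - v) := by
    have hc : Continuous fun v : ℝ => u n (x - v) := (huc n).comp (by fun_prop)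
    exact (hc.integrable_of_hasCompactSupport (hcs.comp_homeomorph (Homeomorph.subLeft x))).const_mul _
  rw [dist_eq_norm, hconv, hgx, ← integral_sub hint1 hint2]
  have hb : ∀ v : ℝ, ‖g v * u n (x - v) - g x * u n (x - v)‖ ≤ ε / 2 * ‖u n (x - v)‖ := by
    intro v
    rw [← sub_mul, norm_mul]
    rcases le_or_gt (δ n) |x - v| with hv | hv
    · rw [hus n _ hv]; simp
    · refine mul_le_mul_of_nonneg_right ?_ (norm_nonneg _)
      have hdist : dist v x < η := by
        rw [dist_comm, Real.dist_eq]; exact hv.trans hn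
      exact le_of_lt (by simpa [dist_eq_norm] using hηg v hdist)
  calc ‖∫ v : ℝ, (g v * u n (x - v) - g x * u n (x - v))‖
      ≤ ∫ v : ℝ, ‖g v * u n (x - v) - g x * u n (x - v)‖ := norm_integral_le_integral_norm _
    _ ≤ ∫ v : ℝ, ε / 2 * ‖u n (x - v)‖ :=
        integral_mono_of_nonneg (Eventually.of_forall fun _ => norm_nonneg _)
          (((integrable_norm huc hus n).comp_sub_left x).const_mul _) (Eventually.of_forall hb)
    _ = ε / 2 := by
        rw [MeasureTheory.integral_const_mul, integral_sub_left_eq_self (fun v => ‖u n v‖) volume x,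
          hun, mul_one]
    _ < ε := by linarith

/-- The mollified function vanishes one unit beyond the support of `g` (`δ_n ≤ 1`). [folklore] -/
theorem weilConv_eq_zero (hδ1 : ∀ n, δ n ≤ 1) (hus : ∀ n x, δ n ≤ |x| → u n x = 0) {R : ℝ}
    (hgs : ∀ v : ℝ, R < |v| → g v = 0) {x : ℝ} (hx : R + 1 < |x|) (n : ℕ) :
    weilConv g (u n) x = 0 := by
  rw [weilConv_apply]
  refine integral_eq_zero_of_ae (Eventually.of_forall fun v => ?_)
  simp only [Pi.zero_apply]
  rcases le_or_gt (δ n) |x - v| with hv | hv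
  · rw [hus n _ hv, mul_zero]
  · have h1 : |x - v| < 1 := hv.trans_le (hδ1 n)
    have h2 : R < |v| := by
      have := abs_sub_abs_le_abs_sub x v
      linarith
    rw [hgs v h2, zero_mul]

/-! ## The three sides along the approximate identity -/

/-- Convergence of the prime term. [folklore] -/
theorem tendsto_weilPrimeTerm (huc : ∀ n, Continuous (u n)) (hδ : Tendsto δ atTop (𝓝 0))
    (hδ1 : ∀ n, δ n ≤ 1) (hus : ∀ n x, δ n ≤ |x| → u n x = 0) (hu1 : ∀ n, ∫ x, u n x = 1)
    (hun : ∀ n, ∫ x, ‖u n x‖ = 1) (hgc : Continuous g) (hgs : HasCompactSupport g) :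
    Tendsto (fun n => weilPrimeTerm (weilConv g (u n))) atTop (𝓝 (weilPrimeTerm g)) := by
  obtain ⟨R, hR0, hR⟩ := WeilContinuous.exists_support_radius hgs
  have hRn : ∀ n, ∀ v : ℝ, R + 1 < |v| → weilConv g (u n) v = 0 := fun n v hv =>
    weilConv_eq_zero hδ1 hus hR hv n
  have hR' : ∀ v : ℝ, R + 1 < |v| → g v = 0 := fun v hv => hR v (by linarith)
  rw [WeilContinuous.weilPrimeTerm_eq_sum_of_support hR']
  simp_rw [WeilContinuous.weilPrimeTerm_eq_sum_of_support (hRn _)]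
  refine tendsto_finsetSum _ fun m _ => ?_
  exact tendsto_const_nhds.mul ((tendsto_weilConv huc hδ hus hu1 hun hgc _).add
    (tendsto_weilConv huc hδ hus hu1 hun hgc _))

/-- Convergence of the polar term. [folklore] -/
theorem tendsto_weilPolarTerm (huc : ∀ n, Continuous (u n)) (hδ : Tendsto δ atTop (𝓝 0))
    (hus : ∀ n x, δ n ≤ |x| → u n x = 0) (hu1 : ∀ n, ∫ x, u n x = 1)
    (hun : ∀ n, ∫ x, ‖u n x‖ = 1) (hgc : Continuous g) (hgs : HasCompactSupport g) :
    Tendsto (fun n => weilPolarTerm (weilConv g (u n))) atTop (𝓝 (weilPolarTerm g)) := by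
  unfold weilPolarTerm
  have hM : ∀ n s, weilMellin (weilConv g (u n)) s = weilMellin g s * weilMellin (u n) s := fun n s =>
    weilMellin_weilConv_holds hgc hgs (huc n) (hasCompactSupport_of_vanish hus n) s
  simp_rw [hM]
  have h0 := (tendsto_weilMellin huc hδ hus hu1 hun 0).const_mul (weilMellin g 0)
  have h1 := (tendsto_weilMellin huc hδ hus hu1 hun 1).const_mul (weilMellin g 1)
  simpa using h0.add h1

/-- Convergence of the archimedean integral (dominated convergence). [folklore] -/
theorem tendsto_weilArchIntegral (huc : ∀ n, Continuous (u n)) (hδ : Tendsto δ atTop (𝓝 0))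
    (hus : ∀ n x, δ n ≤ |x| → u n x = 0) (hu1 : ∀ n, ∫ x, u n x = 1)
    (hun : ∀ n, ∫ x, ‖u n x‖ = 1) (hgc : Continuous g) (hgs : HasCompactSupport g)
    (hA : Integrable fun t : ℝ => weilMellin g (1 / 2 + t * I) * ((Complex.digamma (1 / 4 + t / 2 * I)).re : ℂ)) :
    Tendsto (fun n => weilArchIntegral (weilConv g (u n))) atTop (𝓝 (weilArchIntegral g)) := by
  -- adapted from `WeilContinuous.tendsto_weilArchIntegral_moll` (tree, `WeilExplicitContinuous.lean`)
  unfold weilArchIntegral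
  have hM : ∀ n s, weilMellin (weilConv g (u n)) s = weilMellin g s * weilMellin (u n) s := fun n s =>
    weilMellin_weilConv_holds hgc hgs (huc n) (hasCompactSupport_of_vanish hus n) s
  simp_rw [hM]
  refine tendsto_integral_of_dominated_convergence
    (fun t => ‖weilMellin g (1 / 2 + t * I) * ((Complex.digamma (1 / 4 + t / 2 * I)).re : ℂ)‖) ?_ hA.norm ?_ ?_
  · intro n
    have hc : Continuous fun t : ℝ => weilMellin (u n) (1 / 2 + t * I) :=
      (continuous_weilMellin (huc n) (hasCompactSupport_of_vanish hus n)).comp (by fun_prop)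
    have heq : (fun t : ℝ => weilMellin g (1 / 2 + t * I) * weilMellin (u n) (1 / 2 + t * I) *
        ((Complex.digamma (1 / 4 + t / 2 * I)).re : ℂ)) = fun t : ℝ =>
        (weilMellin g (1 / 2 + t * I) * ((Complex.digamma (1 / 4 + t / 2 * I)).re : ℂ)) *
          weilMellin (u n) (1 / 2 + t * I) := by
      funext t; ring
    rw [heq]
    exact hA.aestronglyMeasurable.mul hc.aestronglyMeasurable
  · intro n
    refine Eventually.of_forall fun t => ?_
    have h1 := norm_weilMellin_half_le hun n t
    calc ‖weilMellin g (1 / 2 + t * I) * weilMellin (u n) (1 / 2 + t * I) *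
          ((Complex.digamma (1 / 4 + t / 2 * I)).re : ℂ)‖
        = ‖weilMellin g (1 / 2 + t * I) * ((Complex.digamma (1 / 4 + t / 2 * I)).re : ℂ)‖ *
            ‖weilMellin (u n) (1 / 2 + t * I)‖ := by
          rw [norm_mul, norm_mul, norm_mul]; ring
      _ ≤ ‖weilMellin g (1 / 2 + t * I) * ((Complex.digamma (1 / 4 + t / 2 * I)).re : ℂ)‖ * 1 := by
          gcongr
      _ = _ := mul_one _
  · refine Eventually.of_forall fun t => ?_
    have h := ((tendsto_weilMellin huc hδ hus hu1 hun (1 / 2 + t * I)).const_mul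
      (weilMellin g (1 / 2 + t * I))).mul_const ((Complex.digamma (1 / 4 + t / 2 * I)).re : ℂ)
    simpa using h

/-- **The Weil functional along an approximate identity**: `W(g ⋆ u_n) → W(g)` for `g` continuous of
compact support with integrable archimedean integrand (in particular for Weil tests).
[cite: Bombieri2000Weil, §3] -/
theorem tendsto_weilFunctional (huc : ∀ n, Continuous (u n)) (hδ : Tendsto δ atTop (𝓝 0))
    (hδ1 : ∀ n, δ n ≤ 1) (hus : ∀ n x, δ n ≤ |x| → u n x = 0) (hu1 : ∀ n, ∫ x, u n x = 1)
    (hun : ∀ n, ∫ x, ‖u n x‖ = 1) (hgc : Continuous g) (hgs : HasCompactSupport g)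
    (hA : Integrable fun t : ℝ => weilMellin g (1 / 2 + t * I) * ((Complex.digamma (1 / 4 + t / 2 * I)).re : ℂ)) :
    Tendsto (fun n => weilFunctional (weilConv g (u n))) atTop (𝓝 (weilFunctional g)) := by
  unfold weilFunctional weilArchTerm
  refine ((tendsto_weilPolarTerm huc hδ hus hu1 hun hgc hgs).sub
    (tendsto_weilPrimeTerm huc hδ hδ1 hus hu1 hun hgc hgs)).add ?_
  refine ((tendsto_weilArchIntegral huc hδ hus hu1 hun hgc hgs hA).const_mul _).sub ?_
  exact (tendsto_weilConv huc hδ hus hu1 hun hgc 0).mul_const _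

end WeilApproxIdentity

end Literature.NumberTheory.LFunctions

end
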